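import Summits.AtomisticToContinuum.FouriersLaw.Theses.OddSectorIrreversibility
import Summits.AtomisticToContinuum.FouriersLaw.Theses.JunctionLocality
import Summits.AtomisticToContinuum.FouriersLaw.Theses.BoundaryEscapeDeficit
import Summits.AtomisticToContinuum.FouriersLaw.Theorems.PhononMeanFreePathBoundaryKubo
import Summits.AtomisticToContinuum.FouriersLaw.Theorems.OddSectorIrreversibilityBoundedResponseConvergesEscapeDeficitForm
import Summits.AtomisticToContinuum.FouriersLaw.Theorems.BoundedResponseConverges.Negative.TwoScaleKillCriteria

/-!
# Line `ohmic-floor-monotone-ladder` (crux stmt-AtomisticToContinuum-9141): the Kubo-value ladder — bridges BY NAME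

Helper file of the lead seat c2 (`--supports stmt-AtomisticToContinuum-9141`). The line's fixed-`N` stub
`stub_cornerKubo` is a corollary of the landed `boundaryKubo_proof` (crux `PhononMeanFreePath.BoundaryKubo`,
stmt-11812): every clause-(ii) response coefficient of the `(N+1)`-chain is the equilibrium Kubo value
`kuboValue N = N·(γ²/T²)·∫₀^∞ Cov_{μ_T}(p_0², K_t p_N²)`. The line's lever `stub_kernelLadder` — EVENTUAL MONOTONICITY
of the real sequence `N ↦ kuboValue ω₂ lam β γ T N`, a statement about equilibrium Gibbs measures and
equal-temperature kernels only — is wired here to the items it decides: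

* `kuboValue_eq_escapeDeficit` — the cross-form Kubo value IS the escape deficit of the `(N+1)`-chain:
  `kuboValue N = N·γ·(1 − (γ/T²)∫₀^∞ K_{N+1})`, `K_{N+1}(u) = ∫ (p_0² − T)·K_u(p_0² − T) dμ_T` (route
  `BoundaryEscapeDeficit`'s `let K, let E` verbatim) — the finite-`N` SUM RULE `(γ/T²)(∫auto + ∫cross) = 1` read
  through the two landed response identities (`boundaryKubo_proof`, `responseIdentity_proof`) along the canonical
  steady-state family (`nessUnique_proof`, `pinnedChain_exists_isSteadyState`); unconditional.
* `boundedResponseConverges_of_kuboLadderUp` — **the predicted (`↑`) branch ALONE closes the crux**: if for all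
  parameters `> 0` and `T > 0` the Kubo values are eventually non-decreasing, then
  `OddSectorIrreversibility.BoundedResponseConverges` (no floor needed: `D (N+1) = kuboValue N`, boundedness is the
  crux's hypothesis, positivity `D_N > 0` for `N ≥ 2` is landed, kill criterion `boundedResponseConverges_ladder_matrix_iff`).
* `conductanceLowerBound_of_kuboLadderUp` — … and closes `JunctionLocality.ConductanceLowerBound` (stmt-11749) too.
* `boundedResponseConverges_of_kuboLadder_of_conductanceLowerBound` — the registered composition of the line as a
  tree theorem: dichotomy ladder + stmt-11749 ⇒ crux.
* `escapeNonOscillation_of_kuboLadder` — the dichotomy ladder ALONE closes the sibling crux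
  `BoundaryEscapeDeficit.EscapeNonOscillation` (stmt-AtomisticToContinuum-12238: the escape-deficit sequence has a limit
  in `EReal`): an eventually monotone real sequence converges in `[−∞, +∞]`.

So the lever `stub_kernelLadder` is, by name, worth: crux 9141 (`↑` branch outright; `↓` branch modulo 11749), item
11749 (`↑` branch) and item 12238 (either branch). The ladder hypotheses are spelled out (no definitions here); pure
bookkeeping over landed theorems; no named facts; standard axioms.
-/

noncomputable section

open MeasureTheory Filter Topology Set

namespace Summit.AtomisticToContinuum.FouriersLaw.Cruxes.BoundedResponseConverges.OhmicFloorMonotoneLadder.Stubs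

open Literature.MathematicalPhysics.KineticTheory.HeatConduction
open Summit.AtomisticToContinuum.FouriersLaw.Theorems.BoundaryKubo.Negative.LoadBearing (kuboIntegrand kuboValue)
open Summit.AtomisticToContinuum.FouriersLaw.Theorems.PhononMeanFreePathBoundaryKubo (boundaryKubo_proof)
open Summit.AtomisticToContinuum.FouriersLaw.Theorems
  (nessUnique_proof responseCoeff_eq_escapeDeficit boundedResponseConverges_ladder_matrix_iff)
open Summit.AtomisticToContinuum.FouriersLaw.Theses

/-! ## The cross-form Kubo value is the escape deficit (finite-`N` sum rule) -/

/-- **`kuboValue N` = escape deficit of the `(N+1)`-chain.** For all parameters `> 0`, `T > 0` and `N`: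
`N·(γ²/T²)·∫₀^∞ Cov_{μ_T}(p_0², K_t p_N²) = N·γ·(1 − (γ/T²)∫₀^∞ ∫ (p_0² − T)·K_u(p_0² − T) dμ_T)`. Both sides are the
value of the SAME response limit `lim_{δ→0,δ≠0} totalCurrent(μ (N+1) (T+δ/2) (T−δ/2))/δ` along the canonical unique
steady-state family: the left by the landed cross-form identity (`boundaryKubo_proof`), the right by the landed
auto-form identity (`responseCoeff_eq_escapeDeficit` ∘ `responseIdentity_proof`).
[cite: KunduDharNarayan2009, arXiv:0809.4543 p. 3] -/
theorem kuboValue_eq_escapeDeficit {ω₂ lam β γ : ℝ} (hω : 0 < ω₂) (hl : 0 < lam) (hβ : 0 < β) (hγ : 0 < γ)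
    {T : ℝ} (hT : 0 < T) (N : ℕ) :
    kuboValue ω₂ lam β γ T N = (N : ℝ) * γ * (1 - γ / T ^ 2 * ∫ u in Set.Ioi (0 : ℝ),
      ∫ z, ((z.2 ⟨0, Nat.succ_pos N⟩) ^ 2 - T) * (∫ y, ((y.2 ⟨0, Nat.succ_pos N⟩) ^ 2 - T)
        ∂((pinnedChain ω₂ lam β γ).transitionKernel (N + 1) T T u.toNNReal z))
        ∂((pinnedChain ω₂ lam β γ).gibbsMeasure (N + 1) T)) := by
  -- weak-NESS uniqueness (landed) and the canonical steady-state family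
  have hU : ∀ (M : ℕ) (T_L T_R : ℝ), 0 < T_L → 0 < T_R → ∀ μ ν : Measure (PhaseSpace M),
      (pinnedChain ω₂ lam β γ).IsSteadyState M T_L T_R μ →
        (pinnedChain ω₂ lam β γ).IsSteadyState M T_L T_R ν → μ = ν :=
    nessUnique_proof ω₂ lam β γ hω hl hβ hγ
  classical
  set μc : (M : ℕ) → ℝ → ℝ → Measure (PhaseSpace M) := fun M T_L T_R =>
    if h : 0 < T_L ∧ 0 < T_R then
      Classical.choose (pinnedChain_exists_isSteadyState hω hl hβ hγ M h.1 h.2) else 0 with hμc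
  have hμc' : ∀ (M : ℕ) (T_L T_R : ℝ), 0 < T_L → 0 < T_R →
      (pinnedChain ω₂ lam β γ).IsSteadyState M T_L T_R (μc M T_L T_R) := by
    intro M T_L T_R hL hR
    have h : 0 < T_L ∧ 0 < T_R := ⟨hL, hR⟩
    simp only [hμc, dif_pos h]
    exact Classical.choose_spec (pinnedChain_exists_isSteadyState hω hl hβ hγ M h.1 h.2)
  -- the response limit of the `(N+1)`-chain along `μc` exists and equals the Kubo value (cross form) …
  have hlim : Tendsto (fun δ : ℝ =>
      (pinnedChain ω₂ lam β γ).totalCurrent (μc (N + 1) (T + δ / 2) (T - δ / 2)) / δ) (𝓝[≠] 0)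
      (𝓝 (kuboValue ω₂ lam β γ T N)) :=
    (boundaryKubo_proof ω₂ lam β γ hω hl hβ hγ hU μc hμc' T hT N).2
  -- … and equals the escape deficit (auto form)
  have h := responseCoeff_eq_escapeDeficit hω hl hβ hγ hU μc hμc' hT (Nat.succ_pos N) hlim
  rw [h]
  push_cast
  ring

/-! ## The response sequence is the shifted Kubo-value sequence -/

section Frame

variable {ω₂ lam β γ : ℝ} (hω : 0 < ω₂) (hl : 0 < lam) (hβ : 0 < β) (hγ : 0 < γ)
  (hU : ∀ (N : ℕ) (T_L T_R : ℝ), 0 < T_L → 0 < T_R → ∀ μ ν : Measure (PhaseSpace N),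
      (pinnedChain ω₂ lam β γ).IsSteadyState N T_L T_R μ →
      (pinnedChain ω₂ lam β γ).IsSteadyState N T_L T_R ν → μ = ν)
  {μ : (N : ℕ) → ℝ → ℝ → Measure (PhaseSpace N)}
  (hμ : ∀ (N : ℕ) (T_L T_R : ℝ), 0 < T_L → 0 < T_R →
        (pinnedChain ω₂ lam β γ).IsSteadyState N T_L T_R (μ N T_L T_R))
  {T : ℝ} (hT : 0 < T) {D : ℕ → ℝ}
  (hD : ∀ N : ℕ, Tendsto (fun δ : ℝ =>
      (pinnedChain ω₂ lam β γ).totalCurrent (μ N (T + δ / 2) (T - δ / 2)) / δ) (𝓝[≠] 0) (𝓝 (D N)))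
include hω hl hβ hγ hU hμ hT hD

/-- Under the crux's frame, `D (N+1) = kuboValue N` for every `N` (cross-form Kubo identity `boundaryKubo_proof` +
uniqueness of limits along `𝓝[≠] 0`). [cite: KunduDharNarayan2009, arXiv:0809.4543 p. 3] -/
theorem response_succ_eq_kuboValue' (N : ℕ) : D (N + 1) = kuboValue ω₂ lam β γ T N :=
  tendsto_nhds_unique (hD (N + 1)) (boundaryKubo_proof ω₂ lam β γ hω hl hβ hγ hU μ hμ T hT N).2

/-- Under the crux's frame the response sequence is eventually non-decreasing as soon as the Kubo values are:
`kuboValue N ≤ kuboValue (N+1)` for `N ≥ N₀` gives `D N ≤ D (N+1)` for `N ≥ N₀ + 1`. [folklore] -/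
theorem response_mono_of_kuboLadderUp {N₀ : ℕ}
    (hup : ∀ N : ℕ, N₀ ≤ N → kuboValue ω₂ lam β γ T N ≤ kuboValue ω₂ lam β γ T (N + 1)) :
    ∀ N : ℕ, N₀ + 1 ≤ N → D N ≤ D (N + 1) := by
  intro N hN
  obtain ⟨M, rfl⟩ : ∃ M, N = M + 1 := ⟨N - 1, by omega⟩
  rw [response_succ_eq_kuboValue' hω hl hβ hγ hU hμ hT hD M,
    response_succ_eq_kuboValue' hω hl hβ hγ hU hμ hT hD (M + 1)]
  exact hup M (by omega)

/-- Likewise for the `↓` branch: `kuboValue (N+1) ≤ kuboValue N` for `N ≥ N₀` gives `D (N+1) ≤ D N` for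
`N ≥ N₀ + 1`. [folklore] -/
theorem response_anti_of_kuboLadderDown {N₀ : ℕ}
    (hdown : ∀ N : ℕ, N₀ ≤ N → kuboValue ω₂ lam β γ T (N + 1) ≤ kuboValue ω₂ lam β γ T N) :
    ∀ N : ℕ, N₀ + 1 ≤ N → D (N + 1) ≤ D N := by
  intro N hN
  obtain ⟨M, rfl⟩ : ∃ M, N = M + 1 := ⟨N - 1, by omega⟩
  rw [response_succ_eq_kuboValue' hω hl hβ hγ hU hμ hT hD M,
    response_succ_eq_kuboValue' hω hl hβ hγ hU hμ hT hD (M + 1)]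
  exact hdown M (by omega)

/-- Conversely, the Kubo values are eventually non-decreasing as soon as ONE response sequence of the crux's frame is:
`D N ≤ D (N+1)` for `N ≥ N₁` gives `kuboValue N ≤ kuboValue (N+1)` for `N + 1 ≥ N₁`. So, under the frame, the `↑` half of
the registered stub `stub_kernelLadder` is EXACTLY eventual monotonicity of the conjunct's own response sequence — no more,
no less. [folklore] -/
theorem kuboLadderUp_of_response_mono {N₁ : ℕ} (hmono : ∀ N : ℕ, N₁ ≤ N → D N ≤ D (N + 1)) :
    ∀ N : ℕ, N₁ ≤ N + 1 → kuboValue ω₂ lam β γ T N ≤ kuboValue ω₂ lam β γ T (N + 1) := by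
  intro N hN
  rw [← response_succ_eq_kuboValue' hω hl hβ hγ hU hμ hT hD N,
    ← response_succ_eq_kuboValue' hω hl hβ hγ hU hμ hT hD (N + 1)]
  exact hmono (N + 1) hN

/-- … and likewise for the `↓` half. [folklore] -/
theorem kuboLadderDown_of_response_anti {N₁ : ℕ} (hanti : ∀ N : ℕ, N₁ ≤ N → D (N + 1) ≤ D N) :
    ∀ N : ℕ, N₁ ≤ N + 1 → kuboValue ω₂ lam β γ T (N + 1) ≤ kuboValue ω₂ lam β γ T N := by
  intro N hN
  rw [← response_succ_eq_kuboValue' hω hl hβ hγ hU hμ hT hD N,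
    ← response_succ_eq_kuboValue' hω hl hβ hγ hU hμ hT hD (N + 1)]
  exact hanti (N + 1) hN

/-- **`↑` branch at one parameter point**: eventually non-decreasing Kubo values + `|D|` bounded ⇒ `D → k > 0`
(positivity `D_N > 0`, `N ≥ 2`, is landed: `TwoScaleGluingLogRigidity.Stubs.stub_positiveConductance`). [folklore] -/
theorem tendsto_pos_of_kuboLadderUp (hbdd : BddAbove (Set.range fun N => |D N|)) {N₀ : ℕ}
    (hup : ∀ N : ℕ, N₀ ≤ N → kuboValue ω₂ lam β γ T N ≤ kuboValue ω₂ lam β γ T (N + 1)) :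
    ∃ k : ℝ, 0 < k ∧ Tendsto D atTop (𝓝 k) := by
  have hmono := response_mono_of_kuboLadderUp hω hl hβ hγ hU hμ hT hD hup
  have hP := TwoScaleGluingLogRigidity.Stubs.stub_positiveConductance ω₂ lam β γ hω hl hβ hγ hU μ hμ T hT D hD
  have hpos : ∃ N : ℕ, N₀ + 1 ≤ N ∧ 0 < D N := ⟨N₀ + 2, by omega, hP _ (by omega)⟩
  exact (boundedResponseConverges_ladder_matrix_iff hmono hbdd).2 hpos

/-- **`↑` branch at one parameter point gives a conductance floor**: `c := D (N₀ + 2) > 0` bounds `D N` from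
below for `N ≥ N₀ + 2`. [folklore] -/
theorem floor_of_kuboLadderUp {N₀ : ℕ}
    (hup : ∀ N : ℕ, N₀ ≤ N → kuboValue ω₂ lam β γ T N ≤ kuboValue ω₂ lam β γ T (N + 1)) :
    ∃ c : ℝ, 0 < c ∧ ∃ N₁ : ℕ, ∀ N : ℕ, N₁ ≤ N → c ≤ D N := by
  have hstep := response_mono_of_kuboLadderUp hω hl hβ hγ hU hμ hT hD hup
  have hmono : Monotone fun n : ℕ => D (N₀ + 1 + n) := by
    refine monotone_nat_of_le_succ fun n => ?_
    have h := hstep (N₀ + 1 + n) (Nat.le_add_right _ _)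
    simpa [Nat.add_assoc] using h
  have hP := TwoScaleGluingLogRigidity.Stubs.stub_positiveConductance ω₂ lam β γ hω hl hβ hγ hU μ hμ T hT D hD
  refine ⟨D (N₀ + 1 + 1), hP (N₀ + 1 + 1) (by omega), N₀ + 1 + 1, fun N hN => ?_⟩
  have h := hmono (show 1 ≤ N - (N₀ + 1) by omega)
  have e : N₀ + 1 + (N - (N₀ + 1)) = N := by omega
  simpa [e] using h

/-- **`↓` branch at one parameter point**: eventually non-increasing Kubo values + `|D|` bounded + a floor `c > 0`
eventually ⇒ `D → k ≥ c > 0`. [folklore] -/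
theorem tendsto_pos_of_kuboLadderDown_of_floor (hbdd : BddAbove (Set.range fun N => |D N|)) {N₀ : ℕ}
    (hdown : ∀ N : ℕ, N₀ ≤ N → kuboValue ω₂ lam β γ T (N + 1) ≤ kuboValue ω₂ lam β γ T N)
    {c : ℝ} (hc : 0 < c) {N₁ : ℕ} (hfloor : ∀ N : ℕ, N₁ ≤ N → c ≤ D N) :
    ∃ k : ℝ, 0 < k ∧ Tendsto D atTop (𝓝 k) := by
  have hstep := response_anti_of_kuboLadderDown hω hl hβ hγ hU hμ hT hD hdown
  have hanti : Antitone fun n : ℕ => D (N₀ + 1 + n) := by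
    refine antitone_nat_of_succ_le fun n => ?_
    have h := hstep (N₀ + 1 + n) (Nat.le_add_right _ _)
    simpa [Nat.add_assoc] using h
  have hbddB : BddBelow (Set.range fun n : ℕ => D (N₀ + 1 + n)) := by
    obtain ⟨B, hB⟩ := hbdd
    refine ⟨-B, ?_⟩
    rintro _ ⟨n, rfl⟩
    exact neg_le.mp ((neg_le_abs _).trans (hB ⟨N₀ + 1 + n, rfl⟩))
  have hlim := tendsto_atTop_ciInf hanti hbddB
  have hkD : Tendsto D atTop (𝓝 (⨅ n : ℕ, D (N₀ + 1 + n))) := by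
    have h2 : Tendsto (fun n => D (n + (N₀ + 1))) atTop (𝓝 (⨅ n : ℕ, D (N₀ + 1 + n))) :=
      hlim.congr fun n => by rw [Nat.add_comm (N₀ + 1) n]
    exact (tendsto_add_atTop_iff_nat (N₀ + 1)).mp h2
  exact ⟨_, lt_of_lt_of_le hc (ge_of_tendsto hkD (eventually_atTop.2 ⟨N₁, hfloor⟩)), hkD⟩

end Frame

/-! ## The `↑` branch closes the crux and the floor outright -/

/-- **The predicted Kubo-value ladder closes `BoundedResponseConverges` (stmt-9141) — no floor needed.** If for all
parameters `> 0` and `T > 0` the equilibrium Kubo values `N ↦ N·(γ²/T²)·∫₀^∞ Cov_{μ_T}(p_0², K_t p_N²)` are eventually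
non-decreasing in the length, then the crux holds: along any family the response sequence is `D (N+1) = kuboValue N`,
eventually non-decreasing, bounded by the crux's hypothesis, and positive for `N ≥ 2` (landed), hence convergent to a
positive limit. [folklore] -/
theorem boundedResponseConverges_of_kuboLadderUp :
    (∀ ω₂ lam β γ : ℝ, 0 < ω₂ → 0 < lam → 0 < β → 0 < γ → ∀ T : ℝ, 0 < T → ∃ N₀ : ℕ, ∀ N : ℕ, N₀ ≤ N →
      Summit.AtomisticToContinuum.FouriersLaw.Theorems.BoundaryKubo.Negative.LoadBearing.kuboValue ω₂ lam β γ T N ≤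
        Summit.AtomisticToContinuum.FouriersLaw.Theorems.BoundaryKubo.Negative.LoadBearing.kuboValue ω₂ lam β γ T (N + 1)) →
      Summit.AtomisticToContinuum.FouriersLaw.Theses.OddSectorIrreversibility.BoundedResponseConverges := by
  intro hL ω₂ lam β γ hω hl hβ hγ hU μ hμ T hT D hD hbdd
  obtain ⟨N₀, hup⟩ := hL ω₂ lam β γ hω hl hβ hγ T hT
  exact tendsto_pos_of_kuboLadderUp hω hl hβ hγ hU hμ hT hD hbdd hup

/-- **The predicted Kubo-value ladder closes `JunctionLocality.ConductanceLowerBound` (stmt-11749).** [folklore] -/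
theorem conductanceLowerBound_of_kuboLadderUp
    (hL : ∀ ω₂ lam β γ : ℝ, 0 < ω₂ → 0 < lam → 0 < β → 0 < γ → ∀ T : ℝ, 0 < T →
      ∃ N₀ : ℕ, ∀ N : ℕ, N₀ ≤ N → kuboValue ω₂ lam β γ T N ≤ kuboValue ω₂ lam β γ T (N + 1)) :
    JunctionLocality.ConductanceLowerBound := by
  intro ω₂ lam β γ hω hl hβ hγ hU μ hμ T hT D hD
  obtain ⟨N₀, hup⟩ := hL ω₂ lam β γ hω hl hβ hγ T hT
  exact floor_of_kuboLadderUp hω hl hβ hγ hU hμ hT hD hup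

/-! ## The dichotomy ladder: crux modulo stmt-11749, and `EscapeNonOscillation` outright -/

/-- **The line's registered composition as a tree theorem**: the dichotomy Kubo-value ladder (verbatim the conclusion
of the registered stub `stub_kernelLadder`) together with the `N`-uniform conductance floor
`JunctionLocality.ConductanceLowerBound` (stmt-11749, the line's `stub_floor`) gives `BoundedResponseConverges`.
`↑` branch: floor idle; `↓` branch: monotone convergence above the floor. [folklore] -/
theorem boundedResponseConverges_of_kuboLadder_of_conductanceLowerBound
    (hL : ∀ ω₂ lam β γ : ℝ, 0 < ω₂ → 0 < lam → 0 < β → 0 < γ → ∀ T : ℝ, 0 < T →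
      ∃ N₀ : ℕ,
        (∀ N : ℕ, N₀ ≤ N → kuboValue ω₂ lam β γ T N ≤ kuboValue ω₂ lam β γ T (N + 1)) ∨
        (∀ N : ℕ, N₀ ≤ N → kuboValue ω₂ lam β γ T (N + 1) ≤ kuboValue ω₂ lam β γ T N))
    (hF : JunctionLocality.ConductanceLowerBound) :
    OddSectorIrreversibility.BoundedResponseConverges := by
  intro ω₂ lam β γ hω hl hβ hγ hU μ hμ T hT D hD hbdd
  obtain ⟨N₀, hlad⟩ := hL ω₂ lam β γ hω hl hβ hγ T hT
  rcases hlad with hup | hdown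
  · exact tendsto_pos_of_kuboLadderUp hω hl hβ hγ hU hμ hT hD hbdd hup
  · obtain ⟨c, hc, N₁, hfloor⟩ := hF ω₂ lam β γ hω hl hβ hγ hU μ hμ T hT D hD
    exact tendsto_pos_of_kuboLadderDown_of_floor hω hl hβ hγ hU hμ hT hD hbdd hdown hc hfloor

/-- An eventually monotone real sequence has a limit in `EReal`. [folklore] -/
theorem exists_tendsto_ereal_of_eventually_monotone {e : ℕ → ℝ} {N₀ : ℕ}
    (h : (∀ N : ℕ, N₀ ≤ N → e N ≤ e (N + 1)) ∨ (∀ N : ℕ, N₀ ≤ N → e (N + 1) ≤ e N)) :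
    ∃ ℓ : EReal, Tendsto (fun N : ℕ => ((e N : ℝ) : EReal)) atTop (𝓝 ℓ) := by
  -- shift to a monotone / antitone sequence and use order-completeness of `EReal`
  have key : ∃ ℓ : EReal, Tendsto (fun n : ℕ => ((e (N₀ + n) : ℝ) : EReal)) atTop (𝓝 ℓ) := by
    rcases h with hup | hdown
    · have hmono : Monotone fun n : ℕ => ((e (N₀ + n) : ℝ) : EReal) := by
        refine monotone_nat_of_le_succ fun n => EReal.coe_le_coe_iff.2 ?_
        have := hup (N₀ + n) (Nat.le_add_right _ _)
        simpa [Nat.add_assoc] using this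
      exact ⟨_, tendsto_atTop_iSup hmono⟩
    · have hanti : Antitone fun n : ℕ => ((e (N₀ + n) : ℝ) : EReal) := by
        refine antitone_nat_of_succ_le fun n => EReal.coe_le_coe_iff.2 ?_
        have := hdown (N₀ + n) (Nat.le_add_right _ _)
        simpa [Nat.add_assoc] using this
      exact ⟨_, tendsto_atTop_iInf hanti⟩
  obtain ⟨ℓ, hℓ⟩ := key
  refine ⟨ℓ, ?_⟩
  have h2 : Tendsto (fun n => ((e (n + N₀) : ℝ) : EReal)) atTop (𝓝 ℓ) :=
    hℓ.congr fun n => by rw [Nat.add_comm N₀ n]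
  exact (tendsto_add_atTop_iff_nat N₀).mp h2

/-- **The dichotomy Kubo-value ladder closes `BoundaryEscapeDeficit.EscapeNonOscillation` (stmt-12238).** By
`kuboValue_eq_escapeDeficit` the escape-deficit sequence `N ↦ (N−1)·γ·E_N` is, from `N = 1` on, the shifted Kubo-value
sequence; an eventually monotone real sequence has a limit in `EReal`. (Either branch; no boundedness, no floor.)
[folklore] -/
theorem escapeNonOscillation_of_kuboLadder
    (hL : ∀ ω₂ lam β γ : ℝ, 0 < ω₂ → 0 < lam → 0 < β → 0 < γ → ∀ T : ℝ, 0 < T →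
      ∃ N₀ : ℕ,
        (∀ N : ℕ, N₀ ≤ N → kuboValue ω₂ lam β γ T N ≤ kuboValue ω₂ lam β γ T (N + 1)) ∨
        (∀ N : ℕ, N₀ ≤ N → kuboValue ω₂ lam β γ T (N + 1) ≤ kuboValue ω₂ lam β γ T N)) :
    BoundaryEscapeDeficit.EscapeNonOscillation := by
  intro ω₂ lam β γ hω hl hβ hγ T hT
  dsimp only
  obtain ⟨N₀, hlad⟩ := hL ω₂ lam β γ hω hl hβ hγ T hT
  -- the escape-deficit sequence and its identification with the shifted Kubo values
  set e : ℕ → ℝ := fun N => ((N : ℝ) - 1) * γ * (1 - γ / T ^ 2 * ∫ u in Set.Ioi (0 : ℝ),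
    if h : 0 < N then ∫ z, ((z.2 ⟨0, h⟩) ^ 2 - T) * (∫ y, ((y.2 ⟨0, h⟩) ^ 2 - T)
      ∂((pinnedChain ω₂ lam β γ).transitionKernel N T T u.toNNReal z))
      ∂((pinnedChain ω₂ lam β γ).gibbsMeasure N T) else 0) with he
  have heK : ∀ N : ℕ, e (N + 1) = kuboValue ω₂ lam β γ T N := by
    intro N
    rw [kuboValue_eq_escapeDeficit hω hl hβ hγ hT N]
    simp only [he, dif_pos (Nat.succ_pos N)]
    push_cast
    ring
  have hmono : (∀ N : ℕ, N₀ + 1 ≤ N → e N ≤ e (N + 1)) ∨ (∀ N : ℕ, N₀ + 1 ≤ N → e (N + 1) ≤ e N) := by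
    rcases hlad with hup | hdown
    · refine Or.inl fun N hN => ?_
      obtain ⟨M, rfl⟩ : ∃ M, N = M + 1 := ⟨N - 1, by omega⟩
      rw [heK M, heK (M + 1)]
      exact hup M (by omega)
    · refine Or.inr fun N hN => ?_
      obtain ⟨M, rfl⟩ : ∃ M, N = M + 1 := ⟨N - 1, by omega⟩
      rw [heK M, heK (M + 1)]
      exact hdown M (by omega)
  exact exists_tendsto_ereal_of_eventually_monotone hmono

end Summit.AtomisticToContinuum.FouriersLaw.Cruxes.BoundedResponseConverges.OhmicFloorMonotoneLadder.Stubs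

end
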